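import Summits.HubbardSuperconductivity.HubbardSuperconductivity.Theorems.AnisotropyChordTransferFibre3FinX3Eval

/-!
# Route `AnisotropyChord` / H0 rotor rung: FIN per-`L` GM₃ (X5), `L = 29` — rows `N₁` / D / side-condition cell facts, part `p52`

Kernel facts (`decide +kernel`) for cert cells 124, 125 of the per-`L` grid of `L = 29`: `xbnCellAny2` (row `N₁` on XB2 point wedges recomputed in the kernel, exporting the literal brackets `nt ⊇ T⁺ − 3λ₂` and `tb ⊇ T⁺·D`), `xdCellAnyN0` (row D, reads `nt`), `sdCellAnyZN` (side condition, reads `nt`); evaluators `…FinX3Eval` / `…FinX5Eval`; constants from the compiled design probe (x3probe/x3plan, margins c ×0.985, b ×1.03, aD ×1.03); assembled in `…FinX5GM3TwentyNine`.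
Prover seat `hubbard-h0-rotor-p3` g8; helper for piece A = stmt-HubbardSuperconductivity-23918 of rung 19089 (`--supports`, helper class).
WHAT THIS IS NOT: nothing here proves superconductivity in the Hubbard model (rotor TARGET as worded stays FALSE, g15 verdict); kernel facts for the FIN certificate of ONE conditional reduction.  Tree imports only; zero data; standard axioms.
-/

set_option linter.dupNamespace false
set_option autoImplicit false

namespace Summit.HubbardSuperconductivity.HubbardSuperconductivity.Theorems.AnisotropyChord.Transfer.Fibre3

namespace FinXD

open FinXB FinCell Hole2

set_option maxHeartbeats 4000000 in
/-- row `N₁` of cell 124 of `L = 29` (`c = 23/40`), exporting `nt`, `tb`. [folklore] -/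
theorem xn29_124 : xbnCellAny2 29 (49/50 : ℚ) 1325543089430459 1358681666666221 (23/40 : ℚ) ((19315439076119 : ℤ), (29308069230144 : ℤ)) ((3995920435948622 : ℤ), (4105377340647681 : ℤ)) = true := by decide +kernel

set_option maxHeartbeats 4000000 in
/-- row D of cell 124 of `L = 29` (`aD = 39/500`). [folklore] -/
theorem xd29_124 : xdCellAnyN0 29 (49/50 : ℚ) 1325543089430459 1358681666666221 (39/500 : ℚ) ((19315439076119 : ℤ), (29308069230144 : ℤ)) = true := by decide +kernel

set_option maxHeartbeats 4000000 in
/-- side condition of cell 124 of `L = 29` (`c, b = 101/100, aD`). [folklore] -/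
theorem sd29_124 : sdCellAnyZN 29 (49/50 : ℚ) 100 1325543089430459 1358681666666221 ((23/40 : ℚ), (101 : ℕ), (39/500 : ℚ)) ((19315439076119 : ℤ), (29308069230144 : ℤ)) = true := by decide +kernel

set_option maxHeartbeats 4000000 in
/-- row `N₁` of cell 125 of `L = 29` (`c = 23/40`), exporting `nt`, `tb`. [folklore] -/
theorem xn29_125 : xbnCellAny2 29 (49/50 : ℚ) 1358681666666221 1392648708332877 (23/40 : ℚ) ((20745391233145 : ℤ), (31325626783903 : ℤ)) ((4096765513027463 : ℤ), (4209296629986879 : ℤ)) = true := by decide +kernel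

set_option maxHeartbeats 4000000 in
/-- row D of cell 125 of `L = 29` (`aD = 39/500`). [folklore] -/
theorem xd29_125 : xdCellAnyN0 29 (49/50 : ℚ) 1358681666666221 1392648708332877 (39/500 : ℚ) ((20745391233145 : ℤ), (31325626783903 : ℤ)) = true := by decide +kernel

set_option maxHeartbeats 4000000 in
/-- side condition of cell 125 of `L = 29` (`c, b = 103/100, aD`). [folklore] -/
theorem sd29_125 : sdCellAnyZN 29 (49/50 : ℚ) 100 1358681666666221 1392648708332877 ((23/40 : ℚ), (103 : ℕ), (39/500 : ℚ)) ((20745391233145 : ℤ), (31325626783903 : ℤ)) = true := by decide +kernel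

end FinXD

end Summit.HubbardSuperconductivity.HubbardSuperconductivity.Theorems.AnisotropyChord.Transfer.Fibre3
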